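import Literature.Barriers.CriticalPhenomena.LaceExpansionIsingAboveFourNNDischarge
import HarnessLib

/-!
# Discharge of `SpreadOutIsing.IsingBubbleMeanField` (bubble condition ⇒ `γ = 1`, uniformly
# spread-out Ising model on `ℤ^d`, `d ≥ 2`, `L ≥ 1`), and the barrier reduced to Sakai's Thm. 1.3

Barrier catalogue `Literature/Barriers/CriticalPhenomena/` (D-0021). The barrier
`LaceExpansionIsingAboveFour` (`LaceExpansionIsingAboveFour.lean`; Sakai 2007, §1.1 and Thm. 1.3)
is the conjunction of three named facts,

`NNIsing.IsingBubbleMeanField ∧ SpreadOutIsing.IsingBubbleMeanField ∧ SpreadOutIsing.Sakai2007_thm13_spreadOut`.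

The first conjunct is the tree's theorem `NNIsing.IsingBubbleMeanField_holds`
(`LaceExpansionIsingAboveFourNNDischarge.lean`). This file makes the SECOND conjunct a theorem
too — Sakai 2007, §1.1: "the finiteness of `Σ_{x∈ℤ^d} G_{p_c}(x)²` … implies that `β = 1/2`,
`γ = 1` and `δ = 3` [a82, abf87, af86, ag83]", exponent `γ`, for the uniformly spread-out model:
`∀ d L, 2 ≤ d → 1 ≤ L → BubbleCondition d L → HasGammaOne d L` — assembled from

* `SpreadOutIsing.IsingBubbleMeanField_of_bubble_susceptibility_upper`
  (`LaceExpansionIsingAboveFourReduction.lean`): everything but Aizenman's upper bound is proved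
  there (`0 < β_c < ∞`, `χ = ∞` on `[β_c, ∞)`, `χ ↑ ∞` and the lower bound `χ_β ≥ c(β_c - β)⁻¹`
  below `β_c`), leaving the named fact `SpreadOutIsing.bubble_susceptibility_upper`;
* `SpreadOutIsing.bubble_susceptibility_upper_of_aizenmanGraham`
  (`LaceExpansionIsingAboveFourBubbleBound.lean`): that upper bound,
  `B(β_c) < ∞ ⇒ χ_β ≤ C(β_c - β)⁻¹` near `β_c` (Aizenman 1982, Prop. 7.1; Aizenman–Graham 1983;
  along Tasaki–Hara 2015, Thm. 10.13, (10.63)–(10.69)), granted the finite-volume Aizenman–Graham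
  inequality in the boxes of the range-`L` graph;
* `aizenmanGraham_inequality_holds` (`Literature/Probability/LatticeModels/AizenmanGrahamInequalityProofs.lean`;
  Tasaki–Hara 2015, Thm. A.18 (A.125), random currents): the Aizenman–Graham inequality on ANY
  locally finite graph, here specialised to `spreadOutGraph d L` and the boxes `box d n`.

Consequently the barrier is now EQUIVALENT to its third conjunct, Sakai's Theorem 1.3 for the
spread-out model (`LaceExpansionIsingAboveFour_iff_sakai2007_thm13`), whose own reduction to named
analysis facts lives in `LaceExpansionIsingDeconvolutionAssembly.lean`
(`Sakai2007_thm13_spreadOut_of_five_facts`). Nothing is restated here; no definition is introduced.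

## References

* A. Sakai, *Lace expansion for the Ising model*, Comm. Math. Phys. 272 (2007) 283–344
  (arXiv:math-ph/0510093), §1.1 and Theorem 1.3 [Sakai2007].
* M. Aizenman, Comm. Math. Phys. 86 (1982) 1–48, Prop. 7.1 [Aizenman1982].
* M. Aizenman, R. Graham, Nucl. Phys. B 225 (1983) 261–288 [AizenmanGraham1983].
* H. Tasaki, T. Hara, 相転移と臨界現象の数理 (Kyoritsu 2015), Thm. 10.13, Thm. A.18 [TasakiHara2015].
-/

noncomputable section

namespace Literature.Barriers.CriticalPhenomena

namespace SpreadOutIsing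

open Literature.Probability.LatticeModels Literature.Probability.Percolation

/-- **Discharge of the named fact `SpreadOutIsing.bubble_susceptibility_upper`** (bubble
condition ⇒ `γ ≤ 1` for the uniformly spread-out Ising model on `ℤ^d`, `d ≥ 2`, `L ≥ 1`: if
`B(β_c) < ∞` then `χ_β ≤ C (β_c - β)⁻¹` on some `(β₀, β_c)`; Aizenman 1982, Aizenman–Graham 1983
as quoted by Sakai 2007, §1.1; Tasaki–Hara 2015, Thm. 10.13): the reduction
`bubble_susceptibility_upper_of_aizenmanGraham` fed with the random-current proof
`aizenmanGraham_inequality_holds` of the finite-volume Aizenman–Graham inequality on the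
range-`L` graph. [cite: Sakai2007, §1.1 (bubble condition ⇒ γ = 1)]
[cite: Aizenman1982, Proposition 7.1] [cite: TasakiHara2015, Ch. 10, Thm. 10.13 with App. A, Thm. A.18] -/
theorem bubble_susceptibility_upper_holds : SpreadOutIsing.bubble_susceptibility_upper :=
  bubble_susceptibility_upper_of_aizenmanGraham fun d L n β =>
    aizenmanGraham_inequality_holds (spreadOutGraph d L) (box d n) β

/-- **`SpreadOutIsing.IsingBubbleMeanField` holds**: for the uniformly spread-out Ising model on
`ℤ^d`, `d ≥ 2`, `L ≥ 1`, the bubble condition `Σ_x G_{β_c}(x)² < ∞` implies `0 < β_c < ∞`,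
`χ_β = ∞` for `β ≥ β_c`, and the mean-field divergence `c(β_c - β)⁻¹ ≤ χ_β ≤ C(β_c - β)⁻¹` on
some `(β₀, β_c)` (`γ = 1`) — Sakai 2007, §1.1, quoting Aizenman 1982 / Aizenman–Graham 1983.
[cite: Sakai2007, §1.1 (bubble condition ⇒ γ = 1)] [cite: Aizenman1982, Proposition 7.1]
[cite: TasakiHara2015, Ch. 10, Thm. 10.13 with App. A, Thm. A.18] -/
theorem IsingBubbleMeanField_holds : SpreadOutIsing.IsingBubbleMeanField :=
  IsingBubbleMeanField_of_bubble_susceptibility_upper bubble_susceptibility_upper_holds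

end SpreadOutIsing

/-- **The barrier from Sakai's Theorem 1.3 alone**: with both bubble-condition conjuncts proved,
`LaceExpansionIsingAboveFour` follows from its third conjunct `Sakai2007_thm13_spreadOut`.
[cite: Sakai2007, §1.1 and Theorem 1.3] -/
theorem LaceExpansionIsingAboveFour_of_sakai2007_thm13
    (h : SpreadOutIsing.Sakai2007_thm13_spreadOut) : LaceExpansionIsingAboveFour :=
  ⟨NNIsing.IsingBubbleMeanField_holds, SpreadOutIsing.IsingBubbleMeanField_holds, h⟩

/-- **The barrier is now equivalent to Sakai's Theorem 1.3 (spread-out model).**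
[cite: Sakai2007, §1.1 and Theorem 1.3] -/
theorem LaceExpansionIsingAboveFour_iff_sakai2007_thm13 :
    LaceExpansionIsingAboveFour ↔ SpreadOutIsing.Sakai2007_thm13_spreadOut :=
  ⟨fun h => h.2.2, LaceExpansionIsingAboveFour_of_sakai2007_thm13⟩

end Literature.Barriers.CriticalPhenomena

end
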